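import Literature.AlgebraicGeometry.Resolution.MacaulayficationOverCMLocus
import Literature.AlgebraicGeometry.Resolution.Blowups
import Literature.AlgebraicGeometry.Resolution.QuasiExcellentSchemes
import HarnessLib

/-!
# Macaulayfication BY A BLOWING UP whose centre misses the Cohen–Macaulay locus (Česnavičius 2021, Thm. 5.3) — named fact

Topic: `Literature/AlgebraicGeometry/Resolution`. Companion of `MacaulayficationOverCMLocus.lean` (which vendors
Česnavičius 2021 Thm. 1.6 in the proper-birational VARIETY form `CesnaviciusMacaulayfication`, recording in its
`TODO(general form)` the precise form Thm. 5.3). This file vendors the BLOW-UP FORM of the same theorem, i.e. the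
statement that controls the CENTRE:

  *"Theorem 5.3. For every CM-excellent, locally equidimensional, Noetherian scheme `X` and finitely many
  coherent `𝒪_X`-modules `ℳ` with `Supp(ℳ) = X`, there is a closed subscheme `Z ⊂ X` that is disjoint from the
  dense open `CM(X) ∩ ⋂_ℳ CM(ℳ)` such that `Bl_Z(X)` is Cohen–Macaulay, and its coherent modules `Bl_Z(ℳ)` are
  also all Cohen–Macaulay."* (arXiv:1810.04493 §5, Theorem (Mac-main) = Duke Math. J. 170 (2021) Thm. 5.3;
  proof of Thm. 1.6 (main-thm-pf) ibid.: "if `X` itself is CM-excellent and locally equidimensional, then we may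
  choose `X' = X`", so that the Macaulayfication of Thm. 1.6 IS `Bl_Z(X) → X`.)

Vendored as a NAMED FACT (`def … : Prop`, not proved in the tree), in the SPECIAL CASE the tree has language for
and in the stalkwise inline vocabulary of `KawasakiMacaulayfication` / `CesnaviciusMacaulayfication`:

* no modules (`ℳ = ∅`, or `ℳ = {𝒪_X}`: then `CM(𝒪_X) = CM(X)`);
* `X` INTEGRAL, Noetherian and EXCELLENT (`Scheme.IsExcellent`: every affine coordinate ring an excellent ring) —
  excellent ⇒ CM-excellent (Česnavičius 2021 (CM-exc-eg), arXiv p. 2: "Every quasi-excellent scheme is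
  CM-quasi-excellent, and similarly for excellence"), and integral ⇒ locally equidimensional (ibid. §2
  (formal-eq): "`X` is locally equidimensional if it is locally Noetherian and each of its local rings `𝒪_{X,x}` is
  equidimensional in the sense that all the irreducible components of `Spec(𝒪_{X,x})` have the same dimension" — a
  local domain has irreducible spectrum);
* "`Z ⊂ X` a closed subscheme disjoint from `CM(X)`" ⟶ an ideal sheaf `Z : X.IdealSheafData` whose support contains
  NO point with Cohen–Macaulay stalk, "Cohen–Macaulay" spelled inline exactly as in `KawasakiMacaulayfication`
  (every system of parameters a weakly regular sequence; Bruns–Herzog 2.1.2 (d));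
* "`Bl_Z(X)` is Cohen–Macaulay" ⟶ for EVERY blowing up `π : X' → X` along `Z` (`IsBlowup`, the universal property,
  Görtz–Wedhorn Def. 13.90; all such are isomorphic over `X`) every stalk of `X'` is Cohen–Macaulay in the same sense.
Users take `(h : CesnaviciusBlowupMacaulayfication)`. Consumed by route `FrobeniusLadder` of summit
`ResolutionOfSingularities` (crux `FInjectiveMacaulayfication`, door «LocalDoor»: the CM-half of the local
FULL-ification stub is this fact applied to an excellent integral local blow-up scheme whose non-CM locus lies in
a closed fibre — summit-side reduction `…LocalMacaulayficationOfFact`).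

This file carries BOTH admitted renderings (director-resolution DR-CZ3, 2026-08-28T03:40:43Z; faithfulness reads res-L1-w45a-tri-2 #326 / #352):
(A) `CesnaviciusBlowupMacaulayfication` — the centre misses the Cohen–Macaulay locus (Thm. 5.3's own form); (B)
`CesnaviciusBlowupMacaulayficationOffClosed` — for any closed `W` off which `X` is Cohen–Macaulay, a centre supported in `W` (a direct consequence of (A):
Thm. 5.3's centre is disjoint from `CM(X) ⊇ X ∖ W`; the 4-line implication is kept summit-side so this file stays statement-only). Users take `(h : CesnaviciusBlowupMacaulayfication)` or
`(h : CesnaviciusBlowupMacaulayficationOffClosed)`.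

## Sources

* K. Česnavičius, *Macaulayfication of Noetherian schemes*, Duke Math. J. 170 (2021) 1419–1455 =
  arXiv:1810.04493: **Theorem 5.3** (Mac-main; quoted above; corpus `paper:arxiv-1810.04493` p15 L21–27), proof
  of Theorem 1.6 (main-thm-pf; p15 L57–80: "if `X` itself is CM-excellent and locally equidimensional, then we may
  choose `X' = X`"), Definition 1.2 and Example 1.3 (CM-(quasi-)excellence; p2 L21–29), §2 (formal-eq) (locally
  equidimensional; p5 L10). [Cesnavicius2021]
* W. Bruns, J. Herzog, *Cohen–Macaulay rings*, 2.1.2 (d) (Cohen–Macaulay ⟺ every system of parameters is a regular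
  sequence). [BrunsHerzog1998]

## What is NOT here

The proof (XL); the general base (CM-excellent, locally equidimensional, possibly non-integral `X`); the module
version (`Bl_Z(ℳ)` Cohen–Macaulay); density of `CM(X)` in `Bl_Z(X)` (Rem. 5.4); projectivity.
-/

noncomputable section

open CategoryTheory AlgebraicGeometry

namespace Literature.AlgebraicGeometry.Resolution

universe u

/-- NAMED FACT — **Česnavičius 2021, Thm. 5.3 (Macaulayfication by a blowing up with centre off the Cohen–Macaulay
locus), special case `X` integral, Noetherian and excellent, no modules**: *"For every CM-excellent, locally
equidimensional, Noetherian scheme `X` … there is a closed subscheme `Z ⊂ X` that is disjoint from the dense open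
`CM(X)` … such that `Bl_Z(X)` is Cohen–Macaulay."* Rendering: an ideal sheaf `Z` on `X` such that NO point of its
support has a Cohen–Macaulay stalk (every system of parameters weakly regular, as in `KawasakiMacaulayfication`),
and EVERY blowing up `π : X' → X` along `Z` (`IsBlowup`) has all its stalks Cohen–Macaulay in the same sense.
(Excellent ⇒ CM-excellent, Ex. 1.3; integral ⇒ locally equidimensional, §2.) Users take
`(h : CesnaviciusBlowupMacaulayfication)`.
-- TODO(general form): X CM-excellent, locally equidimensional, Noetherian (not necessarily integral); finitely many
-- coherent modules ℳ with Supp ℳ = X Macaulayfied simultaneously (Bl_Z(ℳ) Cohen–Macaulay); Z disjoint from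
-- CM(X) ∩ ⋂ CM(ℳ); CM(X) dense in Bl_Z(X) (Rem. 5.4).
[cite: Cesnavicius2021, Thm. 5.3; proof of Thm. 1.6; Ex. 1.3] -/
def CesnaviciusBlowupMacaulayfication : Prop :=
  ∀ (X : Scheme.{u}) [IsIntegral X] [IsNoetherian X], Scheme.IsExcellent X →
    ∃ Z : X.IdealSheafData,
      (∀ x : X, x ∈ (Z.support : Set X) →
        ¬ (∀ d : ℕ, ringKrullDim (X.presheaf.stalk x) = d →
            ∀ s : Fin d → X.presheaf.stalk x, (Ideal.span (Set.range s)).radical.IsMaximal →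
              RingTheory.Sequence.IsWeaklyRegular (X.presheaf.stalk x) (List.ofFn s))) ∧
      ∀ (X' : Scheme.{u}) (π : X' ⟶ X), IsBlowup π Z →
        ∀ x' : X', ∀ d : ℕ, ringKrullDim (X'.presheaf.stalk x') = d →
          ∀ s : Fin d → X'.presheaf.stalk x', (Ideal.span (Set.range s)).radical.IsMaximal →
            RingTheory.Sequence.IsWeaklyRegular (X'.presheaf.stalk x') (List.ofFn s)

/-- NAMED FACT (SUPPORTED FORM of the blow-up Macaulayfication; a direct consequence of Thm. 5.3 as printed) — **Česnavičius 2021, Thm. 5.3, read as: the Macaulayfying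
centre may be taken inside any closed set off which `X` is Cohen–Macaulay.** For `X` integral, Noetherian and excellent and a CLOSED subset
`W ⊆ X` such that every stalk OFF `W` is Cohen–Macaulay, there is an ideal sheaf `Z` with `Supp Z ⊆ W` such that every blowing up of `X` along `Z`
has Cohen–Macaulay stalks (Thm. 5.3's `Z` is disjoint from `CM(X) ⊇ X ∖ W`). Users take `(h : CesnaviciusBlowupMacaulayficationOffClosed)`.
[cite: Cesnavicius2021, Thm. 5.3; proof of Thm. 1.6] -/
def CesnaviciusBlowupMacaulayficationOffClosed : Prop :=
  ∀ (X : Scheme.{u}) [IsIntegral X] [IsNoetherian X], Scheme.IsExcellent X →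
    ∀ W : Set X, IsClosed W →
      (∀ x : X, x ∉ W → ∀ d : ℕ, ringKrullDim (X.presheaf.stalk x) = d →
          ∀ s : Fin d → X.presheaf.stalk x, (Ideal.span (Set.range s)).radical.IsMaximal →
            RingTheory.Sequence.IsWeaklyRegular (X.presheaf.stalk x) (List.ofFn s)) →
      ∃ Z : X.IdealSheafData, (Z.support : Set X) ⊆ W ∧
        ∀ (X' : Scheme.{u}) (π : X' ⟶ X), IsBlowup π Z →
          ∀ x' : X', ∀ d : ℕ, ringKrullDim (X'.presheaf.stalk x') = d →
            ∀ s : Fin d → X'.presheaf.stalk x', (Ideal.span (Set.range s)).radical.IsMaximal →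
              RingTheory.Sequence.IsWeaklyRegular (X'.presheaf.stalk x') (List.ofFn s)


end Literature.AlgebraicGeometry.Resolution

end
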